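import Literature.Analysis.SpecialFunctions.HypergeometricEulerTransformation
import Literature.Analysis.SpecialFunctions.HypergeometricGaussSum
import HarnessLib

/-!
# `₂F₁(a,b;c;−x)` as `x → +∞`: the one-term (convergent) cases of DLMF 15.8.2

Continuation of `HypergeometricPfaff.lean`, `HypergeometricEulerTransformation.lean` and
`HypergeometricGaussSum.lean`. For Euler's hypergeometric function `E(a,b;c;z)` (`0 < Re b < Re c`)
in the throat variable `z = −x`, Pfaff's two transformations send `x → +∞` to `x/(1+x) → 1⁻`:

  `E(a,b;c;−x) = (1+x)^{−a} E(a, c−b; c; x/(1+x)) = (1+x)^{−b} E(c−a, b; c; x/(1+x))`,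

and Gauss's summation theorem evaluates the limits when they converge:

* `tendsto_cpow_mul_eulerHypergeometric_neg_atTop` — for `Re(b − a) > 0`,
  `(1+x)^{a} E(a,b;c;−x) → Γ(c)Γ(b−a)/(Γ(c−a)Γ(b))`, and `tendsto_ofReal_cpow_mul_eulerHypergeometric_neg_atTop`
  — the same with `x^{a}`: the leading term `Γ(c)Γ(b−a)/(Γ(b)Γ(c−a)) · x^{−a}` of DLMF 15.8.2;
* the primed versions — for `Re(a − b) > 0`, `(1+x)^{b} E(a,b;c;−x) → Γ(c)Γ(a−b)/(Γ(a)Γ(c−b))`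
  (the other term of 15.8.2), and with `x^{b}`.

The resonant case `Re(a − b) = 0`, `a ≠ b` (two terms of equal modulus — the near-extremal Kerr
cap amplitudes, `a − b = −2iδ`) needs the connection formula DLMF 15.8.2 / 15.8.4 proper and is
NOT treated here.

References: NIST DLMF (15.8.1), (15.8.2), (15.4.20) [DLMF]; Andrews–Askey–Roy,
*Special Functions* (1999), Thm 2.2.5, Thm 2.2.2 [AndrewsAskeyRoy1999].
-/

noncomputable section

open Filter Metric Set
open scoped Topology

namespace Literature.Analysis.SpecialFunctions.Hypergeometric

/-! ### The change of variable `x ↦ x/(1+x)` -/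

/-- `x/(1+x) → 1⁻` as `x → +∞`. [folklore] -/
theorem tendsto_div_one_add_atTop_nhdsLT :
    Tendsto (fun x : ℝ => x / (1 + x)) atTop (𝓝[<] 1) := by
  have h0 : Tendsto (fun x : ℝ => (1 : ℝ) / (1 + x)) atTop (𝓝 0) :=
    tendsto_const_nhds.div_atTop (tendsto_atTop_add_const_left atTop (1 : ℝ) tendsto_id)
  have h1 : Tendsto (fun x : ℝ => 1 - 1 / (1 + x)) atTop (𝓝 1) := by
    simpa using (tendsto_const_nhds (x := (1 : ℝ))).sub h0
  refine tendsto_nhdsWithin_iff.2 ⟨h1.congr' ?_, ?_⟩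
  · filter_upwards [eventually_gt_atTop (0 : ℝ)] with x hx
    have hx1 : (1 + x : ℝ) ≠ 0 := by linarith
    field_simp
    ring
  · filter_upwards [eventually_gt_atTop (0 : ℝ)] with x hx
    have hx1 : (0 : ℝ) < 1 + x := by linarith
    rw [Set.mem_Iio, div_lt_one hx1]
    linarith

/-- `x^p = (x/(1+x))^p (1+x)^p` for real `x ≥ 0` (principal powers of nonnegative reals).
[folklore] -/
theorem ofReal_cpow_eq_div_cpow_mul (p : ℂ) {x : ℝ} (hx : 0 ≤ x) :
    (x : ℂ) ^ p = ((x / (1 + x) : ℝ) : ℂ) ^ p * (1 + (x : ℂ)) ^ p := by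
  have h1 : (0 : ℝ) < 1 + x := by linarith
  have h1c : (1 : ℂ) + (x : ℂ) ≠ 0 := by exact_mod_cast h1.ne'
  rw [show (1 : ℂ) + (x : ℂ) = ((1 + x : ℝ) : ℂ) by push_cast; ring,
    ← Complex.mul_cpow_ofReal_nonneg (div_nonneg hx h1.le) h1.le]
  congr 1
  push_cast
  field_simp

/-- `(x/(1+x))^p → 1` as `x → +∞` (continuity of the principal power at `1`). [folklore] -/
theorem tendsto_div_one_add_cpow_atTop (p : ℂ) :
    Tendsto (fun x : ℝ => ((x / (1 + x) : ℝ) : ℂ) ^ p) atTop (𝓝 1) := by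
  have hc : ContinuousAt (fun w : ℂ => w ^ p) 1 :=
    ContinuousAt.cpow continuousAt_id continuousAt_const Complex.one_mem_slitPlane
  have h1 : Tendsto (fun x : ℝ => ((x / (1 + x) : ℝ) : ℂ)) atTop (𝓝 (1 : ℂ)) := by
    have h := (Complex.continuous_ofReal.tendsto (1 : ℝ)).comp
      (tendsto_div_one_add_atTop_nhdsLT.mono_right nhdsWithin_le_nhds)
    rw [Complex.ofReal_one] at h
    exact h
  have h2 := hc.tendsto.comp h1
  simp only [Function.comp_def, Complex.one_cpow] at h2
  exact h2

/-! ### `Re(b − a) > 0`: the `x^{−a}` term -/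

/-- For `x > −1`, `(1+x)^{a} E(a,b;c;−x) = E(a, c−b; c; x/(1+x))` (Pfaff's first form).
[cite: DLMF, 15.8.1] -/
theorem cpow_mul_eulerHypergeometric_neg_ofReal (a b c : ℂ) {x : ℝ} (hx : -1 < x) :
    (1 + (x : ℂ)) ^ a * eulerHypergeometric a b c (-(x : ℂ)) =
      eulerHypergeometric a (c - b) c ((x / (1 + x) : ℝ) : ℂ) := by
  have h1 : (1 : ℂ) + (x : ℂ) ≠ 0 := by
    rw [show (1 : ℂ) + (x : ℂ) = ((1 + x : ℝ) : ℂ) by push_cast; ring, Complex.ofReal_ne_zero]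
    exact (by linarith : (1 + x : ℝ) ≠ 0)
  have hpow : (1 + (x : ℂ)) ^ a ≠ 0 := Complex.cpow_ne_zero_iff.2 (Or.inl h1)
  rw [eulerHypergeometric_neg_ofReal_pfaff a b c hx, ← mul_assoc, Complex.cpow_neg,
    mul_inv_cancel₀ hpow, one_mul]
  push_cast
  ring_nf

/-- **DLMF 15.8.2, the `x^{−a}` term, `(1+x)`-normalised**: for `0 < Re b < Re c` and
`Re(b − a) > 0`, `(1+x)^{a} E(a,b;c;−x) → Γ(c)Γ(b−a)/(Γ(c−a)Γ(b))` as `x → +∞` (Pfaff's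
first form and Gauss's theorem for `E(a, c−b; c; ·)` at `1⁻`). [cite: DLMF, 15.8.2] -/
theorem tendsto_cpow_mul_eulerHypergeometric_neg_atTop (a : ℂ) {b c : ℂ} (hb : 0 < b.re)
    (hbc : b.re < c.re) (hba : 0 < (b - a).re) :
    Tendsto (fun x : ℝ => (1 + (x : ℂ)) ^ a * eulerHypergeometric a b c (-(x : ℂ))) atTop
      (𝓝 (Complex.Gamma c * Complex.Gamma (b - a) / (Complex.Gamma (c - a) * Complex.Gamma b))) := by
  have hcb : 0 < (c - b).re := by rw [Complex.sub_re]; linarith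
  have hcbc : (c - b).re < c.re := by rw [Complex.sub_re]; linarith
  have h' : 0 < (c - a - (c - b)).re := by rwa [show c - a - (c - b) = b - a by ring]
  have hG := tendsto_eulerHypergeometric_ofReal_one a hcb hcbc h'
  rw [show c - a - (c - b) = b - a by ring, show c - (c - b) = b by ring] at hG
  refine (hG.comp tendsto_div_one_add_atTop_nhdsLT).congr' ?_
  filter_upwards [eventually_gt_atTop (0 : ℝ)] with x hx
  simp only [Function.comp_apply]
  exact (cpow_mul_eulerHypergeometric_neg_ofReal a b c (by linarith)).symm

/-- **DLMF 15.8.2, the `x^{−a}` term**: for `0 < Re b < Re c` and `Re(b − a) > 0`,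
`x^{a} E(a,b;c;−x) → Γ(c)Γ(b−a)/(Γ(c−a)Γ(b))` as `x → +∞`, i.e.
`E(a,b;c;−x) ~ Γ(c)Γ(b−a)/(Γ(b)Γ(c−a)) · x^{−a}`. [cite: DLMF, 15.8.2] -/
theorem tendsto_ofReal_cpow_mul_eulerHypergeometric_neg_atTop (a : ℂ) {b c : ℂ} (hb : 0 < b.re)
    (hbc : b.re < c.re) (hba : 0 < (b - a).re) :
    Tendsto (fun x : ℝ => (x : ℂ) ^ a * eulerHypergeometric a b c (-(x : ℂ))) atTop
      (𝓝 (Complex.Gamma c * Complex.Gamma (b - a) / (Complex.Gamma (c - a) * Complex.Gamma b))) := by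
  have h := (tendsto_div_one_add_cpow_atTop a).mul
    (tendsto_cpow_mul_eulerHypergeometric_neg_atTop a hb hbc hba)
  rw [one_mul] at h
  refine h.congr' ?_
  filter_upwards [eventually_ge_atTop (0 : ℝ)] with x hx
  rw [← mul_assoc, ← ofReal_cpow_eq_div_cpow_mul a hx]

/-! ### `Re(a − b) > 0`: the `x^{−b}` term -/

/-- For `x > −1` and `0 < Re b < Re c`, `(1+x)^{b} E(a,b;c;−x) = E(c−a, b; c; x/(1+x))`
(Pfaff's second form). [cite: DLMF, 15.8.1] -/
theorem cpow_mul_eulerHypergeometric_neg_ofReal' (a : ℂ) {b c : ℂ} (hb : 0 < b.re)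
    (hbc : b.re < c.re) {x : ℝ} (hx : -1 < x) :
    (1 + (x : ℂ)) ^ b * eulerHypergeometric a b c (-(x : ℂ)) =
      eulerHypergeometric (c - a) b c ((x / (1 + x) : ℝ) : ℂ) := by
  have h1 : (1 : ℂ) + (x : ℂ) ≠ 0 := by
    rw [show (1 : ℂ) + (x : ℂ) = ((1 + x : ℝ) : ℂ) by push_cast; ring, Complex.ofReal_ne_zero]
    exact (by linarith : (1 + x : ℝ) ≠ 0)
  have hpow : (1 + (x : ℂ)) ^ b ≠ 0 := Complex.cpow_ne_zero_iff.2 (Or.inl h1)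
  rw [eulerHypergeometric_neg_ofReal_pfaff' a hb hbc hx, ← mul_assoc, Complex.cpow_neg,
    mul_inv_cancel₀ hpow, one_mul]
  push_cast
  ring_nf

/-- **DLMF 15.8.2, the `x^{−b}` term, `(1+x)`-normalised**: for `0 < Re b < Re c` and
`Re(a − b) > 0`, `(1+x)^{b} E(a,b;c;−x) → Γ(c)Γ(a−b)/(Γ(a)Γ(c−b))` as `x → +∞` (Pfaff's
second form and Gauss's theorem for `E(c−a, b; c; ·)` at `1⁻`). [cite: DLMF, 15.8.2] -/
theorem tendsto_cpow_mul_eulerHypergeometric_neg_atTop' (a : ℂ) {b c : ℂ} (hb : 0 < b.re)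
    (hbc : b.re < c.re) (hab : 0 < (a - b).re) :
    Tendsto (fun x : ℝ => (1 + (x : ℂ)) ^ b * eulerHypergeometric a b c (-(x : ℂ))) atTop
      (𝓝 (Complex.Gamma c * Complex.Gamma (a - b) / (Complex.Gamma a * Complex.Gamma (c - b)))) := by
  have h' : 0 < (c - (c - a) - b).re := by rwa [show c - (c - a) - b = a - b by ring]
  have hG := tendsto_eulerHypergeometric_ofReal_one (c - a) hb hbc h'
  rw [show c - (c - a) - b = a - b by ring, show c - (c - a) = a by ring] at hG
  refine (hG.comp tendsto_div_one_add_atTop_nhdsLT).congr' ?_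
  filter_upwards [eventually_gt_atTop (0 : ℝ)] with x hx
  simp only [Function.comp_apply]
  exact (cpow_mul_eulerHypergeometric_neg_ofReal' a hb hbc (by linarith)).symm

/-- **DLMF 15.8.2, the `x^{−b}` term**: for `0 < Re b < Re c` and `Re(a − b) > 0`,
`x^{b} E(a,b;c;−x) → Γ(c)Γ(a−b)/(Γ(a)Γ(c−b))` as `x → +∞`, i.e.
`E(a,b;c;−x) ~ Γ(c)Γ(a−b)/(Γ(a)Γ(c−b)) · x^{−b}`. [cite: DLMF, 15.8.2] -/
theorem tendsto_ofReal_cpow_mul_eulerHypergeometric_neg_atTop' (a : ℂ) {b c : ℂ} (hb : 0 < b.re)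
    (hbc : b.re < c.re) (hab : 0 < (a - b).re) :
    Tendsto (fun x : ℝ => (x : ℂ) ^ b * eulerHypergeometric a b c (-(x : ℂ))) atTop
      (𝓝 (Complex.Gamma c * Complex.Gamma (a - b) / (Complex.Gamma a * Complex.Gamma (c - b)))) := by
  have h := (tendsto_div_one_add_cpow_atTop b).mul
    (tendsto_cpow_mul_eulerHypergeometric_neg_atTop' a hb hbc hab)
  rw [one_mul] at h
  refine h.congr' ?_
  filter_upwards [eventually_ge_atTop (0 : ℝ)] with x hx
  rw [← mul_assoc, ← ofReal_cpow_eq_div_cpow_mul b hx]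

end Literature.Analysis.SpecialFunctions.Hypergeometric

end
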